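import Mathlib
import Literature.AlgebraicGeometry.Resolution.CohenMacaulayCatenary
import Literature.AlgebraicGeometry.Resolution.CatenaryRings
import HarnessLib

/-!
# GrothendieckConnectedness

Topic `Literature/RingTheory/LocalCohomology`. Named literature fact(s) relocated by the gate from `Summits/Langlands/Langlands/Theorems/SkinnerWilesDefectOneReducibleOrdinaryProModularGrothendieckConnectednessReduction.lean`
(accept-time relocation of `[cite]`d propositions written inline in a Summits proposal; human ruling 2026-08-15).
Sources: Grothendieck1968SGA2.

* `Literature.RingTheory.LocalCohomology.GrothendieckConnectedness`
-/

namespace Literature.RingTheory.LocalCohomology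

open IsLocalRing RingTheory.Sequence

/-- **Grothendieck's connectedness theorem** (SGA 2, Exp. XIII, Théorème 2.1).  Let `A` be a complete
Noetherian local ring, `X = Spec A`, `X' = X ∖ {𝔪}`, and `k ≥ 1` an integer such that
(a_k) the irreducible components of `X'` have dimension `≥ k + 1` — every minimal prime `P` of `A` has
`dim A/P ≥ k + 2` — and (b_k) `X'` is connected in dimension `≥ k`: `X'` is not disconnected by a closed
subset of dimension `< k`, equivalently (as every closed subset of `X` disconnecting `X` contains `𝔪`)
for every two-colouring of the minimal primes of `A` using both colours two minimal primes `C₁, C₂` of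
different colours have `dim A/(C₁ + C₂) ≥ k + 1`.  Let `0 ≤ m ≤ k` and `f₁, …, f_m ∈ 𝔪`,
`B = A/(f₁, …, f_m)`, `Y = Spec B`.  Then `Y` satisfies (a_{k−m}) and (b_{k−m}): every minimal prime `Q`
of `B` has `dim B/Q ≥ k − m + 2`, and two minimal primes of `B` of different colours (for any
two-colouring using both colours) have `dim B/(C₁ + C₂) ≥ k − m + 1`; in particular
`Y' = X' ∩ V(f₁) ∩ ⋯ ∩ V(f_m)` is connected.  (Brodmann–Sharp's form: `c(A/𝔞) ≥ min{c(A), sdim A − 1} − ara 𝔞`;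
here with `ara` replaced by the number of listed generators.)
-- TODO(general form): arbitrary closed subsets `Z'` of dimension `< k − m` of `Y'` (not only unions of
-- components) and `ara 𝔞` in place of `m`; both follow from this form by elementary topology of `Spec`.
[cite: Grothendieck1968SGA2, Exp. XIII Théorème 2.1] [file RingTheory/LocalCohomology/GrothendieckConnectedness] -/
def GrothendieckConnectedness : Prop :=
  ∀ (A : Type) [CommRing A] [IsNoetherianRing A] [IsLocalRing A]
    [IsAdicComplete (IsLocalRing.maximalIdeal A) A] (k : ℕ), 1 ≤ k →
    (∀ P : Ideal A, P ∈ minimalPrimes A → ((k + 2 : ℕ) : WithBot ℕ∞) ≤ ringKrullDim (A ⧸ P)) →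
    (∀ S : Set (PrimeSpectrum A), (∃ C ∈ S, C.asIdeal ∈ minimalPrimes A) →
      (∃ C ∉ S, C.asIdeal ∈ minimalPrimes A) →
        ∃ C₁ ∈ S, ∃ C₂ ∉ S, C₁.asIdeal ∈ minimalPrimes A ∧ C₂.asIdeal ∈ minimalPrimes A ∧
          ((k + 1 : ℕ) : WithBot ℕ∞) ≤ ringKrullDim (A ⧸ (C₁.asIdeal ⊔ C₂.asIdeal))) →
    ∀ (fs : List A), (∀ f ∈ fs, f ∈ IsLocalRing.maximalIdeal A) → fs.length ≤ k →
      (∀ Q : Ideal (A ⧸ Ideal.ofList fs), Q ∈ minimalPrimes (A ⧸ Ideal.ofList fs) →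
        ((k - fs.length + 2 : ℕ) : WithBot ℕ∞) ≤ ringKrullDim ((A ⧸ Ideal.ofList fs) ⧸ Q)) ∧
      (∀ S : Set (PrimeSpectrum (A ⧸ Ideal.ofList fs)),
        (∃ C ∈ S, C.asIdeal ∈ minimalPrimes (A ⧸ Ideal.ofList fs)) →
        (∃ C ∉ S, C.asIdeal ∈ minimalPrimes (A ⧸ Ideal.ofList fs)) →
          ∃ C₁ ∈ S, ∃ C₂ ∉ S, C₁.asIdeal ∈ minimalPrimes (A ⧸ Ideal.ofList fs) ∧
            C₂.asIdeal ∈ minimalPrimes (A ⧸ Ideal.ofList fs) ∧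
            ((k - fs.length + 1 : ℕ) : WithBot ℕ∞) ≤
              ringKrullDim ((A ⧸ Ideal.ofList fs) ⧸ (C₁.asIdeal ⊔ C₂.asIdeal)))

/-! ## 2. Cohen–Macaulay bookkeeping: coheights of primes of small height -/

end Literature.RingTheory.LocalCohomology
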